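import Summits.CriticalPhenomena.PercolationContinuityZ3.Theorems.PercNearOneGluingNoHeavyLowerTailSuperTerminalQuarticHubCylinders
import Summits.CriticalPhenomena.PercolationContinuityZ3.Theorems.PercNearOneGluingNoHeavyLowerTailSuperTerminalQuarticHubAlgebra
import Summits.CriticalPhenomena.PercolationContinuityZ3.Theorems.PercNearOneGluingNoHeavyLowerTailSuperTerminalQuarticOneHub
import Summits.CriticalPhenomena.PercolationContinuityZ3.Theorems.PercNearOneGluingNoHeavyLowerTailSuperTerminalQuarticFace
import Mathlib.Algebra.BigOperators.Fin
import HarnessLib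

/-!
# THEOREM H4 (bipartite form): the super-terminal quartic law `V4` on every weighted `K_{4,k}` (THEOREM H4, part 3d — assembly)

Support file for crux `stmt-CriticalPhenomena-4575` (`NoHeavyLowerTail`), seat `prim-facecert` gen 21 (`--supports stmt-CriticalPhenomena-4575`);
memo `run/shared/lean/prim/prim-l12/prim-facecert/FINDING-gen21-V4-HUB-GRAPHS.md`.  No sorries, standard axioms.

**THEOREM (`superTerminalQuartic_hubGraph`).**  Let `μ = prodBernoulli w` on a finite vertex type, `c u a b` pairwise distinct, and suppose
every pair of non-terminals and every pair of terminals has weight `0` (all weighted complete bipartite graphs `K_{4,k}` between `{c,u,a,b}` and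
the hubs — the lead's family `khub4(k)`, every `k`, arbitrary weights).  Then `V4` holds:
`μ(F ∩ c∤T)⁴ ≤ μ(F ∩ c∤{u,a})² · μ(F ∩ c≁b)² · μ(c∤T)`, `F = {u↔a} ∩ {u↮b}`, `T = {u,a,b}` — the hypothesis of
`SuperTerminalQuarticFace.p3_half_of_superTerminalQuartic`; hence `P3_{1/2}` on these graphs (`p3_half_hubGraph`).
Proof: the pieces are the hubs, enumerated by `hubAt`; `…HubCylinders` turns `Q, A, C` into products of the single-hub factors of
`…HubProb`, the creator events `creatorEv j` (hubs before `j` attach `b` to nothing and do not join `u,a`; hub `j` joins `u,a` and not `b`;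
hubs after `j` attach `b` to nothing) are pairwise disjoint sub-events of `F ∩ {c≁b}` with product probabilities, so
`B ≥ Σ_j μ(creatorEv j) = B̃`; `SuperTerminalQuarticHubAlgebra.invariant_range` (fed with `SuperTerminalQuarticOneHub.hub_*_sqrt`) and
`superTerminalQuartic_of_invariant` conclude.  [this work]
-/

namespace Summit.CriticalPhenomena.PercolationContinuityZ3.Theorems.SuperTerminalQuarticHubGraphs

open MeasureTheory Set Finset
open Literature.Probability.Percolation Literature.Probability.LatticeModels
open Summit.CriticalPhenomena.PercolationContinuityZ3.Theorems.SuperTerminalQuarticHubEvents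
open Summit.CriticalPhenomena.PercolationContinuityZ3.Theorems.SuperTerminalQuarticHubProb
open Summit.CriticalPhenomena.PercolationContinuityZ3.Theorems.SuperTerminalQuarticHubCylinders
open scoped Classical

variable {V : Type*} [Fintype V] [DecidableEq V]

/-! ## Enumerating the hubs -/

section enum
variable {c u a b : V}

/-- `hubAt i` is a hub for `i < #hubs`. [this work] -/
theorem hubAt_mem {i : ℕ} (hi : i < Fintype.card (hubs4 c u a b)) : hubAt c u a b i ∈ hubs4 c u a b := by
  simp only [hubAt, dif_pos hi]
  exact Finset.coe_mem _

/-- `hubIdx` is a left inverse of `hubAt` on `range #hubs`. [this work] -/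
theorem hubIdx_hubAt {i : ℕ} (hi : i < Fintype.card (hubs4 c u a b)) : hubIdx c u a b (hubAt c u a b i) = i := by
  have hm := hubAt_mem (c := c) (u := u) (a := a) (b := b) hi
  simp only [hubIdx, dif_pos hm]
  have : (⟨hubAt c u a b i, hm⟩ : hubs4 c u a b) = (Fintype.equivFin (hubs4 c u a b)).symm ⟨i, hi⟩ := by
    apply Subtype.ext
    simp only [hubAt, dif_pos hi]
  rw [this, Equiv.apply_symm_apply]

/-- The index of a hub is `< #hubs`. [this work] -/
theorem hubIdx_lt {v : V} (hv : v ∈ hubs4 c u a b) : hubIdx c u a b v < Fintype.card (hubs4 c u a b) := by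
  simp only [hubIdx, dif_pos hv]
  exact Fin.isLt _

/-- `hubAt` is a left inverse of `hubIdx` on the hubs. [this work] -/
theorem hubAt_hubIdx {v : V} (hv : v ∈ hubs4 c u a b) : hubAt c u a b (hubIdx c u a b v) = v := by
  simp only [hubAt, dif_pos (hubIdx_lt hv)]
  have : (⟨hubIdx c u a b v, hubIdx_lt hv⟩ : Fin _) = Fintype.equivFin (hubs4 c u a b) ⟨v, hv⟩ := by
    apply Fin.ext
    simp only [hubIdx, dif_pos hv]
  rw [this, Equiv.symm_apply_apply]

/-- Reindexing a product over the hubs along the enumeration. [this work] -/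
theorem prod_hubs_eq_prod_range (g : V → ℝ) :
    ∏ h ∈ hubs4 c u a b, g h = ∏ i ∈ range (Fintype.card (hubs4 c u a b)), g (hubAt c u a b i) := by
  rw [← Fin.prod_univ_eq_prod_range (fun i => g (hubAt c u a b i)), ← Finset.prod_coe_sort (hubs4 c u a b) g,
    ← Equiv.prod_comp (Fintype.equivFin (hubs4 c u a b)).symm (fun x : hubs4 c u a b => g (x : V))]
  refine Fintype.prod_congr _ _ fun i => ?_
  simp only [hubAt, dif_pos i.isLt]

end enum

/-! ## The creator events and the disjoint-events bound `B̃ ≤ B` -/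

section creators
variable (w : Sym2 V → unitInterval) {c u a b : V}

/-- `creatorH j h` is determined by `star4 h`. [this work] -/
theorem determinedBy_creatorH (j : ℕ) (h : V) :
    DeterminedBy (creatorH c u a b j h) (↑(star4 c u a b h) : Set (Sym2 V)) := by
  have hb : ({b} : Finset V) ⊆ terms4 c u a b := by simp [terms4]
  unfold creatorH
  split_ifs
  · refine (determinedBy_hSep hb h).inter (ThreePointHubEvents.determinedBy_of_iff fun ω ω' hF => ?_)
    simp only [mem_setOf_eq]
    rw [hF _ (mem_star4.2 ⟨u, by simp [terms4], rfl⟩), hF _ (mem_star4.2 ⟨a, by simp [terms4], rfl⟩)]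
  · refine ThreePointHubEvents.determinedBy_of_iff fun ω ω' hF => ?_
    simp only [mem_setOf_eq]
    rw [hF _ (mem_star4.2 ⟨u, by simp [terms4], rfl⟩), hF _ (mem_star4.2 ⟨a, by simp [terms4], rfl⟩),
      hF _ (mem_star4.2 ⟨b, by simp [terms4], rfl⟩)]
  · exact determinedBy_hSep hb h

/-- **Probability of the `j`-th creator event** = `cre_j · Π_{i<j} (n+e)_i · Π_{j<i<k} mB_i` (hub-event probabilities along the
enumeration). [this work] -/
theorem real_creatorEv (hterm : ∀ x ∈ terms4 c u a b, ∀ y ∈ terms4 c u a b, x ≠ y → (w s(x, y) : ℝ) = 0)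
    {j : ℕ} (hj : j < Fintype.card (hubs4 c u a b)) :
    (prodBernoulli w).real (creatorEv c u a b j) =
      (∏ i ∈ range j, (prodBernoulli w).real
          (hSep {b} c u a b (hubAt c u a b i) ∩ {ω | ¬ (s(u, hubAt c u a b i) ∈ ω ∧ s(a, hubAt c u a b i) ∈ ω)})) *
        ((prodBernoulli w).real {ω : BondConfig V | s(u, hubAt c u a b j) ∈ ω ∧ s(a, hubAt c u a b j) ∈ ω ∧ s(b, hubAt c u a b j) ∉ ω} *
          ∏ i ∈ Ico (j + 1) (Fintype.card (hubs4 c u a b)), (prodBernoulli w).real (hSep {b} c u a b (hubAt c u a b i))) := by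
  have hb : ({b} : Finset V) ⊆ terms4 c u a b := by simp [terms4]
  unfold creatorEv
  rw [real_tInter3_hInter w hb hb hb hterm (fun h _ => determinedBy_creatorH j h),
    prod_hubs_eq_prod_range (fun h => (prodBernoulli w).real (creatorH c u a b j h)),
    ← prod_range_mul_prod_Ico _ hj.le, prod_eq_prod_Ico_succ_bot hj]
  congr 1
  · refine prod_congr rfl fun i hi => ?_
    have hi' : i < j := mem_range.1 hi
    rw [creatorH, hubIdx_hubAt (hi'.trans hj), if_pos hi']
  · congr 1
    · rw [creatorH, hubIdx_hubAt hj, if_neg (lt_irrefl j), if_pos rfl]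
    · refine prod_congr rfl fun i hi => ?_
      have hi' := mem_Ico.1 hi
      rw [creatorH, hubIdx_hubAt hi'.2, if_neg (by omega), if_neg (by omega)]

/-- The creator events are pairwise disjoint. [this work] -/
theorem creatorEv_disjoint : (↑(range (Fintype.card (hubs4 c u a b))) : Set ℕ).PairwiseDisjoint (creatorEv c u a b) := by
  intro j1 hj1 j2 hj2 hne
  rw [Function.onFun, Set.disjoint_left]
  intro ω h1 h2
  -- w.l.o.g. look at the smaller index: its hub is a creator in one event and a prefix hub in the other
  rcases lt_or_gt_of_ne hne with hlt | hlt
  · have hj1' : j1 < Fintype.card (hubs4 c u a b) := mem_range.1 (Finset.mem_coe.1 hj1)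
    have hm := hubAt_mem (c := c) (u := u) (a := a) (b := b) hj1'
    have e1 := (mem_iInter₂.1 h1.2) (hubAt c u a b j1) hm
    have e2 := (mem_iInter₂.1 h2.2) (hubAt c u a b j1) hm
    rw [creatorH, hubIdx_hubAt hj1', if_neg (lt_irrefl _), if_pos rfl] at e1
    rw [creatorH, hubIdx_hubAt hj1', if_pos hlt] at e2
    exact e2.2 ⟨e1.1, e1.2.1⟩
  · have hj2' : j2 < Fintype.card (hubs4 c u a b) := mem_range.1 (Finset.mem_coe.1 hj2)
    have hm := hubAt_mem (c := c) (u := u) (a := a) (b := b) hj2'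
    have e1 := (mem_iInter₂.1 h1.2) (hubAt c u a b j2) hm
    have e2 := (mem_iInter₂.1 h2.2) (hubAt c u a b j2) hm
    rw [creatorH, hubIdx_hubAt hj2', if_pos hlt] at e1
    rw [creatorH, hubIdx_hubAt hj2', if_neg (lt_irrefl _), if_pos rfl] at e2
    exact e1.2 ⟨e2.1, e2.2.1⟩

/-- Each creator event lies in `F ∩ {c≁b}` off the null event. [this work] -/
theorem creatorEv_subset (hcu : c ≠ u) (hca : c ≠ a) (hcb : c ≠ b) (hua : u ≠ a) (hub : u ≠ b) (hab : a ≠ b)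
    {j : ℕ} (hj : j < Fintype.card (hubs4 c u a b)) :
    creatorEv c u a b j ⊆ (openConn u a ∩ (openConn u b)ᶜ ∩ (openConn c b)ᶜ : Set (BondConfig V)) ∪ bad4 c u a b := by
  intro ω hω
  by_cases hN : ω ∈ bad4 c u a b
  · exact Or.inr hN
  refine Or.inl (memB_of hcb hub hab hN ?_ ?_)
  · -- `b` is isolated: terminal part from `tSep {b}`, every hub part implies `hSep {b}`
    refine ⟨hω.1.1.1, mem_iInter₂.2 fun h hh => ?_⟩
    have e := (mem_iInter₂.1 hω.2) h hh
    unfold creatorH at e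
    split_ifs at e with h1 h2
    · exact e.1
    · rw [mem_hSep_b hcu hca hcb hua hub hab]
      exact fun hh' => e.2.2 hh'.1
    · exact e
  · -- `u ↔ a` through the creator hub
    have hm := hubAt_mem (c := c) (u := u) (a := a) (b := b) hj
    have e := (mem_iInter₂.1 hω.2) (hubAt c u a b j) hm
    rw [creatorH, hubIdx_hubAt hj, if_neg (lt_irrefl _), if_pos rfl] at e
    have hne := mem_hubs4.1 hm
    have h1 : (openGraph ω).Reachable u (hubAt c u a b j) :=
      SimpleGraph.Adj.reachable ((openGraph_adj ω _ _).2 ⟨e.1, fun h => hne (Or.inr (Or.inl h.symm))⟩)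
    have h2 : (openGraph ω).Reachable (hubAt c u a b j) a :=
      SimpleGraph.Adj.reachable ((openGraph_adj ω _ _).2 ⟨by rw [Sym2.eq_swap]; exact e.2.1,
        fun h => hne (Or.inr (Or.inr (Or.inl h)))⟩)
    exact h1.trans h2

/-- **The disjoint-events bound `B̃ ≤ B`.** [this work] -/
theorem sum_creator_le_B (hcu : c ≠ u) (hca : c ≠ a) (hcb : c ≠ b) (hua : u ≠ a) (hub : u ≠ b) (hab : a ≠ b)
    (hcov : ∀ x ∈ hubs4 c u a b, ∀ y ∈ hubs4 c u a b, x ≠ y → (w s(x, y) : ℝ) = 0) :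
    ∑ j ∈ range (Fintype.card (hubs4 c u a b)), (prodBernoulli w).real (creatorEv c u a b j) ≤
      (prodBernoulli w).real (openConn u a ∩ (openConn u b)ᶜ ∩ (openConn c b)ᶜ : Set (BondConfig V)) := by
  rw [← measureReal_biUnion_finset creatorEv_disjoint (fun _ _ => MeasurableSet.of_discrete)]
  calc (prodBernoulli w).real (⋃ j ∈ range (Fintype.card (hubs4 c u a b)), creatorEv c u a b j)
      ≤ (prodBernoulli w).real ((openConn u a ∩ (openConn u b)ᶜ ∩ (openConn c b)ᶜ : Set (BondConfig V)) ∪ bad4 c u a b) :=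
        measureReal_mono (iUnion₂_subset fun j hj => creatorEv_subset hcu hca hcb hua hub hab (mem_range.1 hj))
    _ ≤ (prodBernoulli w).real (openConn u a ∩ (openConn u b)ᶜ ∩ (openConn c b)ᶜ : Set (BondConfig V)) +
          (prodBernoulli w).real (bad4 c u a b) := measureReal_union_le _ _
    _ = _ := by rw [real_bad4 w hcov, add_zero]

end creators

/-! ## Assembly -/

section main
variable (w : Sym2 V → unitInterval) {c u a b : V}

omit [Fintype V] [DecidableEq V] in
/-- Nonnegativity of the single-hub quantities for weights in `[0,1]`. [this work] -/
theorem hub_nonneg {r s₁ a₁ b₁ : ℝ} (hr0 : 0 ≤ r) (hr1 : r ≤ 1) (hs0 : 0 ≤ s₁) (hs1 : s₁ ≤ 1) (ha0 : 0 ≤ a₁) (ha1 : a₁ ≤ 1)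
    (hb0 : 0 ≤ b₁) (hb1 : b₁ ≤ 1) :
    0 ≤ (1 - s₁) * (1 - a₁) * (1 - b₁) + (1 - r) * (s₁ * (1 - a₁) * (1 - b₁) + (1 - s₁) * a₁ * (1 - b₁) + (1 - s₁) * (1 - a₁) * b₁) ∧
      0 ≤ (1 - r) * s₁ * a₁ * (1 - b₁) ∧ 0 ≤ r * (1 - s₁) * (1 - a₁) * b₁ ∧
      0 ≤ r * s₁ * (1 - a₁) * (1 - b₁) + r * (1 - s₁) * a₁ * (1 - b₁) ∧
      0 ≤ (1 - r) * s₁ * a₁ * (1 - b₁) + r * s₁ * a₁ * (1 - b₁) ∧ 0 ≤ (1 - b₁) + (1 - r) * (1 - s₁) * (1 - a₁) * b₁ ∧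
      0 ≤ (1 - r) + r * (1 - s₁) * (1 - a₁) * (1 - b₁) := by
  have hrc : 0 ≤ 1 - r := by linarith
  have hsc : 0 ≤ 1 - s₁ := by linarith
  have hac : 0 ≤ 1 - a₁ := by linarith
  have hbc : 0 ≤ 1 - b₁ := by linarith
  exact ⟨by positivity, by positivity, by positivity, by positivity, by positivity, by positivity, by positivity⟩

/-- **THEOREM H4 (bipartite form): the super-terminal quartic law `V4` on every weighted `K_{4,k}`.**  For `μ = prodBernoulli w`, pairwise
distinct `c u a b`, all hub–hub and all terminal–terminal pairs of weight `0`: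
`μ({u↔a} ∩ {u↮b} ∩ {c ∤ {u,a,b}})⁴ ≤ μ({u↔a} ∩ {u↮b} ∩ {c ∤ {u,a}})² · μ({u↔a} ∩ {u↮b} ∩ {c↮b})² · μ(c ∤ {u,a,b})`. [this work] -/
theorem superTerminalQuartic_hubGraph (hcu : c ≠ u) (hca : c ≠ a) (hcb : c ≠ b) (hua : u ≠ a) (hub : u ≠ b) (hab : a ≠ b)
    (hcov : ∀ x ∈ hubs4 c u a b, ∀ y ∈ hubs4 c u a b, x ≠ y → (w s(x, y) : ℝ) = 0)
    (hterm : ∀ x ∈ terms4 c u a b, ∀ y ∈ terms4 c u a b, x ≠ y → (w s(x, y) : ℝ) = 0) :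
    (prodBernoulli w).real (openConn u a ∩ (openConn u b)ᶜ ∩ ((openConn c u)ᶜ ∩ (openConn c a)ᶜ ∩ (openConn c b)ᶜ) : Set (BondConfig V)) ^ 4 ≤
      (prodBernoulli w).real (openConn u a ∩ (openConn u b)ᶜ ∩ ((openConn c u)ᶜ ∩ (openConn c a)ᶜ) : Set (BondConfig V)) ^ 2 *
        (prodBernoulli w).real (openConn u a ∩ (openConn u b)ᶜ ∩ (openConn c b)ᶜ : Set (BondConfig V)) ^ 2 *
          (prodBernoulli w).real ((openConn c u)ᶜ ∩ (openConn c a)ᶜ ∩ (openConn c b)ᶜ : Set (BondConfig V)) := by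
  set K := Fintype.card (hubs4 c u a b) with hK
  -- the piece sequences along the enumeration of the hubs
  set nS : ℕ → ℝ := fun i => ((1 - (w s(u, hubAt c u a b i) : ℝ)) * (1 - (w s(a, hubAt c u a b i) : ℝ)) * (1 - (w s(b, hubAt c u a b i) : ℝ)) + (1 - (w s(c, hubAt c u a b i) : ℝ)) * ((w s(u, hubAt c u a b i) : ℝ) * (1 - (w s(a, hubAt c u a b i) : ℝ)) * (1 - (w s(b, hubAt c u a b i) : ℝ)) + (1 - (w s(u, hubAt c u a b i) : ℝ)) * (w s(a, hubAt c u a b i) : ℝ) * (1 - (w s(b, hubAt c u a b i) : ℝ)) + (1 - (w s(u, hubAt c u a b i) : ℝ)) * (1 - (w s(a, hubAt c u a b i) : ℝ)) * (w s(b, hubAt c u a b i) : ℝ))) with hnS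
  set pS : ℕ → ℝ := fun i => ((1 - (w s(c, hubAt c u a b i) : ℝ)) * (w s(u, hubAt c u a b i) : ℝ) * (w s(a, hubAt c u a b i) : ℝ) * (1 - (w s(b, hubAt c u a b i) : ℝ))) with hpS
  set dS : ℕ → ℝ := fun i => ((w s(c, hubAt c u a b i) : ℝ) * (1 - (w s(u, hubAt c u a b i) : ℝ)) * (1 - (w s(a, hubAt c u a b i) : ℝ)) * (w s(b, hubAt c u a b i) : ℝ)) with hdS
  set eS : ℕ → ℝ := fun i => ((w s(c, hubAt c u a b i) : ℝ) * (w s(u, hubAt c u a b i) : ℝ) * (1 - (w s(a, hubAt c u a b i) : ℝ)) * (1 - (w s(b, hubAt c u a b i) : ℝ)) + (w s(c, hubAt c u a b i) : ℝ) * (1 - (w s(u, hubAt c u a b i) : ℝ)) * (w s(a, hubAt c u a b i) : ℝ) * (1 - (w s(b, hubAt c u a b i) : ℝ))) with heS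
  set creS : ℕ → ℝ := fun i => ((1 - (w s(c, hubAt c u a b i) : ℝ)) * (w s(u, hubAt c u a b i) : ℝ) * (w s(a, hubAt c u a b i) : ℝ) * (1 - (w s(b, hubAt c u a b i) : ℝ))) + ((w s(c, hubAt c u a b i) : ℝ) * (w s(u, hubAt c u a b i) : ℝ) * (w s(a, hubAt c u a b i) : ℝ) * (1 - (w s(b, hubAt c u a b i) : ℝ))) with hcreS
  set mBS : ℕ → ℝ := fun i => ((1 - (w s(b, hubAt c u a b i) : ℝ)) + (1 - (w s(c, hubAt c u a b i) : ℝ)) * (1 - (w s(u, hubAt c u a b i) : ℝ)) * (1 - (w s(a, hubAt c u a b i) : ℝ)) * (w s(b, hubAt c u a b i) : ℝ)) with hmBS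
  set gS : ℕ → ℝ := fun i => ((1 - (w s(c, hubAt c u a b i) : ℝ)) + (w s(c, hubAt c u a b i) : ℝ) * (1 - (w s(u, hubAt c u a b i) : ℝ)) * (1 - (w s(a, hubAt c u a b i) : ℝ)) * (1 - (w s(b, hubAt c u a b i) : ℝ))) with hgS
  set vS : ℕ → ℝ := fun i => Real.sqrt (((1 - (w s(c, hubAt c u a b i) : ℝ)) + (w s(c, hubAt c u a b i) : ℝ) * (1 - (w s(u, hubAt c u a b i) : ℝ)) * (1 - (w s(a, hubAt c u a b i) : ℝ)) * (1 - (w s(b, hubAt c u a b i) : ℝ)))) with hvS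
  have h01 : ∀ e : Sym2 V, 0 ≤ (w e : ℝ) ∧ (w e : ℝ) ≤ 1 := fun e => ⟨(w e).2.1, (w e).2.2⟩
  -- the invariant of the algebraic core
  have INV := SuperTerminalQuarticHubAlgebra.invariant_range nS pS dS (fun _ => 0) eS creS mBS vS K
    (fun i _ => (hub_nonneg (h01 _).1 (h01 _).2 (h01 _).1 (h01 _).2 (h01 _).1 (h01 _).2 (h01 _).1 (h01 _).2).1)
    (fun i _ => (hub_nonneg (h01 _).1 (h01 _).2 (h01 _).1 (h01 _).2 (h01 _).1 (h01 _).2 (h01 _).1 (h01 _).2).2.1)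
    (fun i _ => (hub_nonneg (h01 _).1 (h01 _).2 (h01 _).1 (h01 _).2 (h01 _).1 (h01 _).2 (h01 _).1 (h01 _).2).2.2.1)
    (fun _ _ => le_refl 0)
    (fun i _ => (hub_nonneg (h01 _).1 (h01 _).2 (h01 _).1 (h01 _).2 (h01 _).1 (h01 _).2 (h01 _).1 (h01 _).2).2.2.2.1)
    (fun i _ => (hub_nonneg (h01 _).1 (h01 _).2 (h01 _).1 (h01 _).2 (h01 _).1 (h01 _).2 (h01 _).1 (h01 _).2).2.2.2.2.1)
    (fun i _ => (hub_nonneg (h01 _).1 (h01 _).2 (h01 _).1 (h01 _).2 (h01 _).1 (h01 _).2 (h01 _).1 (h01 _).2).2.2.2.2.2.1)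
    (fun i _ => Real.sqrt_nonneg _)
    (fun i _ => by
      rw [add_zero]
      exact SuperTerminalQuarticOneHub.hub_eq_sqrt (h01 _).1 (h01 _).2 (h01 _).1 (h01 _).2 (h01 _).1 (h01 _).2 (h01 _).1 (h01 _).2)
    (fun i _ => SuperTerminalQuarticOneHub.hub_lt_sqrt (h01 _).1 (h01 _).2 (h01 _).1 (h01 _).2 (h01 _).1 (h01 _).2 (h01 _).1 (h01 _).2)
    (fun i _ => by
      rw [add_zero]
      exact SuperTerminalQuarticOneHub.hub_gt_sqrt (h01 _).1 (h01 _).2 (h01 _).1 (h01 _).2 (h01 _).1 (h01 _).2 (h01 _).1 (h01 _).2)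
  obtain ⟨hI, -⟩ := INV
  -- identification of the products with the `V4` probabilities
  have eQ : (prodBernoulli w).real (openConn u a ∩ (openConn u b)ᶜ ∩ ((openConn c u)ᶜ ∩ (openConn c a)ᶜ ∩ (openConn c b)ᶜ) : Set (BondConfig V)) = (∏ i ∈ range K, (nS i + pS i)) - ∏ i ∈ range K, nS i := by
    rw [real_Q w hcu hca hcb hua hub hab hcov hterm, prod_congr rfl (fun h _ => real_hSep_cb w hcu hca hcb hua hub hab),
      prod_congr rfl (fun h _ => real_hSep_cbu w hcu hca hcb hua hub hab), prod_hubs_eq_prod_range, prod_hubs_eq_prod_range]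
  have eA : (prodBernoulli w).real (openConn u a ∩ (openConn u b)ᶜ ∩ ((openConn c u)ᶜ ∩ (openConn c a)ᶜ) : Set (BondConfig V)) = (∏ i ∈ range K, (nS i + pS i + dS i + 0)) - ∏ i ∈ range K, (nS i + dS i) := by
    rw [real_A w hcu hca hua hub hab hcov hterm, prod_congr rfl (fun h _ => real_hSep_ua w hcu hca hcb hua hub hab),
      prod_congr rfl (fun h _ => real_hSep_u_a w hcu hca hcb hua hub hab), prod_hubs_eq_prod_range, prod_hubs_eq_prod_range]
    simp only [add_zero]
    rfl
  have eC : (prodBernoulli w).real ((openConn c u)ᶜ ∩ (openConn c a)ᶜ ∩ (openConn c b)ᶜ : Set (BondConfig V)) = ∏ i ∈ range K, gS i := by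
    rw [real_C w hcu hca hcb hcov hterm, prod_congr rfl (fun h _ => real_hSep_c w hcu hca hcb hua hub hab), prod_hubs_eq_prod_range]
  have eV : (∏ i ∈ range K, vS i) ^ 2 = (prodBernoulli w).real ((openConn c u)ᶜ ∩ (openConn c a)ᶜ ∩ (openConn c b)ᶜ : Set (BondConfig V)) := by
    rw [eC, ← Finset.prod_pow]
    refine prod_congr rfl fun i _ => ?_
    exact Real.sq_sqrt (hub_nonneg (h01 _).1 (h01 _).2 (h01 _).1 (h01 _).2 (h01 _).1 (h01 _).2 (h01 _).1 (h01 _).2).2.2.2.2.2.2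
  have eBt : (∑ j ∈ range K, creS j * (∏ i ∈ range j, (nS i + eS i)) * ∏ i ∈ Ico (j + 1) K, mBS i) =
      ∑ j ∈ range K, (prodBernoulli w).real (creatorEv c u a b j) := by
    refine sum_congr rfl fun j hj => ?_
    rw [real_creatorEv w hterm (mem_range.1 hj), prod_congr rfl (fun i _ => real_prefix w hcu hca hcb hua hub hab),
      real_creator w hcu hca hcb hua hub hab, prod_congr rfl (fun i _ => real_hSep_b w hcu hca hcb hua hub hab)]
    ring
  have hBt : 0 ≤ ∑ j ∈ range K, (prodBernoulli w).real (creatorEv c u a b j) := sum_nonneg fun _ _ => measureReal_nonneg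
  rw [eBt] at hI
  rw [← eQ, ← eA] at hI
  exact SuperTerminalQuarticHubAlgebra.superTerminalQuartic_of_invariant measureReal_nonneg hBt
    (sum_creator_le_B w hcu hca hcb hua hub hab hcov) (prod_nonneg fun _ _ => Real.sqrt_nonneg _) eV hI

/-- **Corollary: the reverse-Harris row `P3_{1/2}` on every weighted `K_{4,k}`** (`μ(F)·μ(c↔T) ≤ 2·μ(F ∩ c↔T)`), by
`SuperTerminalQuarticFace.p3_half_of_superTerminalQuartic`. [this work] -/
theorem p3_half_hubGraph (hcu : c ≠ u) (hca : c ≠ a) (hcb : c ≠ b) (hua : u ≠ a) (hub : u ≠ b) (hab : a ≠ b)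
    (hcov : ∀ x ∈ hubs4 c u a b, ∀ y ∈ hubs4 c u a b, x ≠ y → (w s(x, y) : ℝ) = 0)
    (hterm : ∀ x ∈ terms4 c u a b, ∀ y ∈ terms4 c u a b, x ≠ y → (w s(x, y) : ℝ) = 0) :
    (prodBernoulli w).real (openConn u a ∩ (openConn u b)ᶜ : Set (BondConfig V)) *
        (prodBernoulli w).real ((openConn c u)ᶜ ∩ (openConn c a)ᶜ ∩ (openConn c b)ᶜ : Set (BondConfig V))ᶜ ≤
      2 * (prodBernoulli w).real (openConn u a ∩ (openConn u b)ᶜ ∩ ((openConn c u)ᶜ ∩ (openConn c a)ᶜ ∩ (openConn c b)ᶜ)ᶜ : Set (BondConfig V)) :=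
  SuperTerminalQuarticFace.p3_half_of_superTerminalQuartic w u a b c (superTerminalQuartic_hubGraph w hcu hca hcb hua hub hab hcov hterm)

end main

end Summit.CriticalPhenomena.PercolationContinuityZ3.Theorems.SuperTerminalQuarticHubGraphs
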